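import Mathlib.Algebra.Group.Action.Sum
import Mathlib.Algebra.Group.Action.Sigma
import Mathlib.Topology.Algebra.OpenSubgroup
import Literature.AnabelianGeometry.SemiGraphs.NonCommensurabilityProofs
import Literature.AnabelianGeometry.SemiGraphs.GraphOfAnabelioidsGalois
import Literature.AnabelianGeometry.SemiGraphs.CoverticialVertexCaseTools
import Literature.AnabelianGeometry.Anabelioids.FiberRealization
import HarnessLib

/-!
# [SemiAnbd] Proposition 2.6, vertex case — the two coverings of the approximator (pp. 28–29)

Mochizuki, *Semi-graphs of anabelioids*, Publ. RIMS **42** (2006), proof of Proposition 2.6,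
author's manuscript pp. 28–29 [cite: MochizukiSemiAnbd2006, Prop. 2.6 pp.28-29].  For the
approximator `𝒢′` (connected, of bounded order) of the vertex case, the proof uses two objects:

* "a normal open subgroup `K ⊆ Π′_𝕂` such that `Π′_w` injects into `Π′_𝕂/K`, for all vertices `w`"
  — here, via the unconditional Prop. 2.5 (ii) (`exists_openNormal_injective_of_isOfBoundedOrder`),
  an object `Y` of `B(𝒢′)` whose fibre is (two copies of) `Π_{𝒢′}/N′` for a normal open `N′` meeting
  every vertex group and every branch group trivially (`exists_galoisCovering`): every element of
  `Π_{𝒢′}` fixing one point of the fibre of `Y` fixes all of it, and all vertex/edge constituents of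
  `Y` have FREE fibres of one common cardinality `2d`;
* over the elevated vertex `v`, "a union of `M′/2[Π′_v : N_M]` copies of the covering defined by the
  `Π′_v`-set `Π′_v/N_M` and of `M′/2[Π′_v : 1]` copies of a universal covering of `𝒢′_v`"
  (`exists_vertexPiece`): an object `P` of `𝒢′_v` of fibre cardinality `2d` on which `N_M` has a
  fixed point and acts faithfully, and whose pull-back to every branch at `v` has a free fibre —
  "the restriction of any of these coverings … to an abutting edge `e` is isomorphic to a union of
  universal coverings of `𝒢′_e`", by the defining property of `N_M` (Def. 2.4 (i): trivial
  intersection with all conjugates of the `Π′_b`); hence (`exists_vertexPiece_glue`) `b^* P ≅ Y_e`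
  for every branch `b` at `v` ("by choosing appropriate gluing isomorphisms").

Proof-only (objects realised by `Anabelioids.exists_obj_fiber_equiv`; `B(𝒢′)` is a Galois category
by abc-iut-L3-t9's `galoisCategory_bObj`). Seat abc-iut-L6-t18 (division of Prop. 2.6 with
abc-iut-L3-d1, 2026-08-25).
-/

namespace Literature.AnabelianGeometry.SemiGraphs

open CategoryTheory CategoryTheory.Limits CategoryTheory.PreGaloisCategory
open Literature.AnabelianGeometry.Anabelioids
open scoped Pointwise

universe v₁ u₁ u

namespace SemiGraphOfAnabelioids

variable (𝒢 : SemiGraphOfAnabelioids.{v₁, u₁, u})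

/-- Change of basepoint ([GeoAn] §1.1 p. 10: `π₁(X, β) ≃ π₁(X, β′)` "up to inner automorphism"):
Mathlib's `Aut.autMulEquivOfIso` along an isomorphism of basepoints IS conjugation `Iso.conjAut` — the
identification used throughout [SemiAnbd] §2 when "`Π_v`, `Π_b` are well-defined up to conjugation".
[cite: MochizukiGeoAn2004, §1.1 p.10] -/
theorem autMulEquivOfIso_apply {C : Type*} [Category C] {X Y : C} (α : X ≅ Y) (σ : Aut X) :
    Aut.autMulEquivOfIso α σ = α.conjAut σ :=
  Iso.ext (by rw [Iso.conjAut_hom, Iso.conj_apply]; rfl)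

/-- **The Galois covering of the approximator** ([SemiAnbd] p. 28: "a normal open subgroup … such
that `Π′_w` injects … for all vertices `w`", realised as an OBJECT): for connected `𝒢` of bounded
order and a basepoint `Ψ = ρ_{x₀} ⋙ F₀` of `B(𝒢)`, there are an object `Y ∈ B(𝒢)` and `d ≥ 1` such
that (1) an element of `Π_𝒢 = Aut Φ` (any basepoint `Φ`) fixing one point of `Φ(Y)` fixes every
point; (2) for every vertex `x` and basepoint `F` of `𝒢_x`, `Π_x` acts freely on `F(Y_x)`, of
cardinality `2d`; (3) likewise `Π_e` on `F(Y_e)` for every branch of `e` abutting to a vertex;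
(4) `[Π_x : 1]` divides `d` for every vertex `x`. [cite: MochizukiSemiAnbd2006, Prop. 2.6 p.28] -/
theorem exists_galoisCovering (hc : 𝒢.IsConnected) (hbo : 𝒢.IsOfBoundedOrder)
    (x₀ : 𝒢.graph.Vertex) (F₀ : 𝒢.V x₀ ⥤ FintypeCat.{v₁}) [FiberFunctor F₀] :
    ∃ (Y : 𝒢.BObj) (d : ℕ), 1 ≤ d ∧
      (letI := 𝒢.preGaloisCategory_bObj
       ∀ (Φ : 𝒢.BObj ⥤ FintypeCat.{v₁}) [FiberFunctor Φ] (τ : Aut Φ),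
        (∃ y : Φ.obj Y, τ • y = y) → ∀ y : Φ.obj Y, τ • y = y) ∧
      (∀ (x : 𝒢.graph.Vertex) (F : 𝒢.V x ⥤ FintypeCat.{v₁}) [FiberFunctor F],
        (∀ (σ : Aut F) (t : F.obj (Y.S x)), σ • t = t → σ = 1) ∧ Nat.card (F.obj (Y.S x)) = 2 * d ∧
          Nat.card (Aut F) ∣ d) ∧
      (∀ (b : 𝒢.graph.Branch) (x : 𝒢.graph.Vertex) (h : 𝒢.graph.abuts b = some x)
        (F : 𝒢.E (𝒢.graph.edgeOf b) ⥤ FintypeCat.{v₁}) [FiberFunctor F],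
        (∀ (σ : Aut F) (t : F.obj (Y.T (𝒢.graph.edgeOf b))), σ • t = t → σ = 1) ∧
          Nat.card (F.obj (Y.T (𝒢.graph.edgeOf b))) = 2 * d) := by
  classical
  letI := 𝒢.preGaloisCategory_bObj
  haveI : GaloisCategory 𝒢.BObj := 𝒢.galoisCategory_bObj hc
  haveI : FiberFunctor (𝒢.ρ x₀ ⋙ F₀) := 𝒢.fiberFunctor_ρ hc x₀ F₀
  -- Prop 2.5 (ii): an open normal subgroup meeting every vertex and branch group trivially
  obtain ⟨N', hN', hopen, hV, hB⟩ := exists_openNormal_injective_of_isOfBoundedOrder 𝒢 hbo x₀ F₀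
  haveI := hN'
  haveI : Finite (Aut (𝒢.ρ x₀ ⋙ F₀) ⧸ N') := Subgroup.quotient_finite_of_isOpen N' hopen
  haveI : N'.FiniteIndex := Subgroup.finiteIndex_of_finite_quotient
  let d : ℕ := N'.index
  have hd : 1 ≤ d := Nat.one_le_iff_ne_zero.mpr Subgroup.FiniteIndex.index_ne_zero
  -- the `Π_𝒢`-set: two copies of `Π_𝒢/N'`
  let X : Type (max u u₁ v₁) := (Aut (𝒢.ρ x₀ ⋙ F₀) ⧸ N') ⊕ (Aut (𝒢.ρ x₀ ⋙ F₀) ⧸ N')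
  -- stabilisers are all `N'`
  have hstabQ : ∀ (σ : Aut (𝒢.ρ x₀ ⋙ F₀)) (q : Aut (𝒢.ρ x₀ ⋙ F₀) ⧸ N'), σ • q = q ↔ σ ∈ N' := by
    intro σ q
    induction q using QuotientGroup.induction_on with
    | H g =>
      rw [MulAction.Quotient.smul_mk, smul_eq_mul, QuotientGroup.eq,
        show (σ * g)⁻¹ * g = g⁻¹ * σ⁻¹ * g by group]
      constructor
      · intro h
        have h' := hN'.conj_mem _ h g
        rw [show g * (g⁻¹ * σ⁻¹ * g) * g⁻¹ = σ⁻¹ by group] at h'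
        exact inv_mem_iff.mp h'
      · intro h
        have h' := hN'.conj_mem _ (inv_mem h) g⁻¹
        rw [inv_inv] at h'
        exact h'
  have hstabX : ∀ (σ : Aut (𝒢.ρ x₀ ⋙ F₀)) (y : X), σ • y = y ↔ σ ∈ N' := by
    intro σ y
    rcases y with q | q
    · rw [Sum.smul_inl, Sum.inl.injEq, hstabQ]
    · rw [Sum.smul_inr, Sum.inr.injEq, hstabQ]
  have hXopen : ∀ y : X,
      IsOpen (MulAction.stabilizer (Aut (𝒢.ρ x₀ ⋙ F₀)) y : Set (Aut (𝒢.ρ x₀ ⋙ F₀))) := by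
    intro y
    have : MulAction.stabilizer (Aut (𝒢.ρ x₀ ⋙ F₀)) y = N' := by
      ext σ; rw [MulAction.mem_stabilizer_iff, hstabX]
    rw [this]; exact hopen
  obtain ⟨Y, eY, heY⟩ := exists_obj_fiber_equiv (𝒢.ρ x₀ ⋙ F₀) X hXopen
  have hcardX : Nat.card X = 2 * d := by
    rw [Nat.card_sum, ← Subgroup.index_eq_card]; ring
  -- (1) at the basepoint `ρ_{x₀} ⋙ F₀`, then at any basepoint
  have h1 : ∀ τ : Aut (𝒢.ρ x₀ ⋙ F₀), (∃ y : (𝒢.ρ x₀ ⋙ F₀).obj Y, τ • y = y) →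
      ∀ y : (𝒢.ρ x₀ ⋙ F₀).obj Y, τ • y = y := by
    rintro τ ⟨y, hy⟩ y'
    have hτ : τ ∈ N' := by
      rw [← hstabX τ (eY y), ← heY, hy]
    apply eY.injective
    rw [heY, (hstabX τ (eY y')).mpr hτ]
  refine ⟨Y, d, hd, ?_, ?_, ?_⟩
  · intro Φ _ τ hτ y
    obtain ⟨γ⟩ := nonempty_iso_of_fiberFunctor' Φ (𝒢.ρ x₀ ⋙ F₀)
    exact forall_smul_eq_of_iso γ Y (fun τ' hτ' y' => h1 τ' hτ' y') τ hτ y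
  · intro x F _
    haveI : FiberFunctor (𝒢.ρ x ⋙ F) := 𝒢.fiberFunctor_ρ hc x F
    obtain ⟨α⟩ := nonempty_iso_of_fiberFunctor' (𝒢.ρ x ⋙ F) (𝒢.ρ x₀ ⋙ F₀)
    have hinj := hV x F α
    -- freeness of the vertex fibre
    have hfree : ∀ (σ : Aut F) (t : F.obj (Y.S x)), σ • t = t → σ = 1 := by
      intro σ t ht
      have h2 : (α.conjAut (𝒢.piVToPi x F σ)) • (α.hom.app Y t) = α.hom.app Y t := by
        rw [conjAut_smul_app]
        exact congrArg _ ht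
      have h3 : α.conjAut (𝒢.piVToPi x F σ) ∈ N' := by
        rw [← hstabX _ (eY (α.hom.app Y t)), ← heY, h2]
      apply hinj
      rw [map_one, MonoidHom.comp_apply, MonoidHom.comp_apply, MulEquiv.coe_toMonoidHom,
        autMulEquivOfIso_apply, QuotientGroup.mk'_apply, (QuotientGroup.eq_one_iff _).mpr h3]
    refine ⟨hfree, ?_, ?_⟩
    · change Nat.card ((𝒢.ρ x ⋙ F).obj Y) = 2 * d
      rw [card_fiber_eq_of_iso_fiberFunctor α Y, Nat.card_congr eY, hcardX]
    · -- `Aut F ↪ Π/N'`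
      have := Subgroup.card_dvd_of_injective _ hinj
      rwa [← Subgroup.index_eq_card] at this
  · intro b x h F _
    haveI : FiberFunctor ((𝒢.pull b x h).pullback ⋙ F) :=
      fiberFunctor_comp_of_exact (𝒢.pull b x h).pullback F
    haveI : FiberFunctor (𝒢.ρ x ⋙ ((𝒢.pull b x h).pullback ⋙ F)) := 𝒢.fiberFunctor_ρ hc x _
    obtain ⟨α⟩ := nonempty_iso_of_fiberFunctor' (𝒢.ρ x ⋙ ((𝒢.pull b x h).pullback ⋙ F))
      (𝒢.ρ x₀ ⋙ F₀)
    have hinj := hB b x h F α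
    -- transport along the gluing isomorphism `ψ_b : b^* Y_x ≅ Y_e` (an `Aut F`-equivariant bijection)
    let ψ := Y.ψ b x h
    have hψ : ∀ (σ : Aut F) (t : F.obj ((𝒢.pull b x h).pullback.obj (Y.S x))),
        σ • F.map ψ.hom t = F.map ψ.hom (σ • t) := fun σ t => mulAction_naturality F σ ψ.hom t
    have hbij : Function.Bijective (F.map ψ.hom) :=
      ConcreteCategory.bijective_of_isIso (F.map ψ.hom)
    have hfree : ∀ (σ : Aut F) (t : F.obj (Y.T (𝒢.graph.edgeOf b))), σ • t = t → σ = 1 := by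
      intro σ t ht
      obtain ⟨t₀, rfl⟩ := hbij.2 t
      rw [hψ] at ht
      have ht₀ : σ • t₀ = t₀ := hbij.1 ht
      -- `σ` acts on `F(b^* Y_x) = (ρ_x ⋙ b^* ⋙ F)(Y)` as `π₁(b) σ`
      have h2 : (α.conjAut (𝒢.piBToPi b x h F σ)) • (α.hom.app Y t₀) = α.hom.app Y t₀ := by
        rw [conjAut_smul_app]
        exact congrArg _ ht₀
      have h3 : α.conjAut (𝒢.piBToPi b x h F σ) ∈ N' := by
        rw [← hstabX _ (eY (α.hom.app Y t₀)), ← heY, h2]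
      apply hinj
      rw [map_one, MonoidHom.comp_apply, MonoidHom.comp_apply, MulEquiv.coe_toMonoidHom,
        autMulEquivOfIso_apply, QuotientGroup.mk'_apply, (QuotientGroup.eq_one_iff _).mpr h3]
    refine ⟨hfree, ?_⟩
    rw [← Nat.card_congr (Equiv.ofBijective _ hbij)]
    change Nat.card ((𝒢.ρ x ⋙ ((𝒢.pull b x h).pullback ⋙ F)).obj Y) = 2 * d
    rw [card_fiber_eq_of_iso_fiberFunctor α Y, Nat.card_congr eY, hcardX]

/-- **The local piece over the elevated vertex** ([SemiAnbd] p. 28: "Over `v`, we take this covering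
to be a union of `M′/2[Π′_v : N_M]` copies of the covering defined by the `Π′_v`-set `Π′_v/N_M` and of
`M′/2[Π′_v : 1]` copies of a universal covering of `𝒢′_v`"): for a basepoint `F₁` of `𝒢_v` with finite
`Π_v = Aut F₁` of order dividing `d`, and a finite subgroup `N ⊆ Π_v` meeting every conjugate of every
branch group `Π_b` (`b` abutting to `v`) trivially (Def. 2.4 (i)), there is an object `P` of `𝒢_v`
with fibre of cardinality `2d` such that (1) some point of `F₁(P)` is fixed by `N`, and distinct
elements of `N` act differently on `F₁(P)`; (2) for every branch `b` at `v` and basepoint `F` of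
`𝒢_e`, `Π_e` acts freely on `F(b^* P)` ("the restriction … to an abutting edge `e` is isomorphic to a
union of universal coverings of `𝒢′_e`"), of cardinality `2d`.
[cite: MochizukiSemiAnbd2006, Prop. 2.6 p.28] -/
theorem exists_vertexPiece (hinj : 𝒢.IsOfInjectiveType) (v : 𝒢.graph.Vertex)
    (F₁ : 𝒢.V v ⥤ FintypeCat.{v₁}) [FiberFunctor F₁] [Finite (Aut F₁)] {d : ℕ}
    (hdvd : Nat.card (Aut F₁) ∣ d) (hd : 1 ≤ d) (N : Subgroup (Aut F₁))
    (hN : ∀ (b : 𝒢.graph.Branch) (h : 𝒢.graph.abuts b = some v)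
      (Fe : 𝒢.E (𝒢.graph.edgeOf b) ⥤ FintypeCat.{v₁}) [FiberFunctor Fe]
      (α : (𝒢.pull b v h).pullback ⋙ Fe ≅ F₁) (g : Aut F₁),
      N ⊓ (ConjAct.toConjAct g • 𝒢.branchSubgroup F₁ b h Fe α) = ⊥) :
    ∃ P : 𝒢.V v, Nat.card (F₁.obj P) = 2 * d ∧
      (∃ t₀ : F₁.obj P, (∀ n ∈ N, n • t₀ = t₀) ∧
        ∀ n ∈ N, ∀ n' ∈ N, (∀ t : F₁.obj P, n • t = n' • t) → n = n') ∧
      ∀ (b : 𝒢.graph.Branch) (h : 𝒢.graph.abuts b = some v)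
        (F : 𝒢.E (𝒢.graph.edgeOf b) ⥤ FintypeCat.{v₁}) [FiberFunctor F],
        (∀ (σ : Aut F) (t : F.obj ((𝒢.pull b v h).pullback.obj P)), σ • t = t → σ = 1) ∧
          Nat.card (F.obj ((𝒢.pull b v h).pullback.obj P)) = 2 * d := by
  classical
  obtain ⟨r, hr⟩ := hdvd
  have hG : 0 < Nat.card (Aut F₁) := Nat.card_pos
  have hr1 : 1 ≤ r := by
    rcases Nat.eq_zero_or_pos r with h0 | h0
    · subst h0; simp at hr; omega
    · exact h0
  haveI : Finite N := inferInstance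
  -- the `Π_v`-set: `|N|` copies of `Π_v/N` and `2r − 1` copies of `Π_v`
  let X : Type (max u₁ v₁) :=
    (Σ _ : Fin (Nat.card N), Aut F₁ ⧸ N) ⊕ (Σ _ : Fin (2 * r - 1), Aut F₁)
  have hcardX : Nat.card X = 2 * d := by
    rw [Nat.card_sum, Nat.card_congr (Equiv.sigmaEquivProd _ _),
      Nat.card_congr (Equiv.sigmaEquivProd _ _), Nat.card_prod, Nat.card_prod, Nat.card_fin,
      Nat.card_fin, ← Subgroup.index_eq_card, mul_comm (Nat.card N) N.index, Subgroup.index_mul_card,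
      hr]
    have h2 : 2 * r - 1 + 1 = 2 * r := by omega
    calc Nat.card (Aut F₁) + (2 * r - 1) * Nat.card (Aut F₁)
        = (2 * r - 1 + 1) * Nat.card (Aut F₁) := by ring
      _ = 2 * (Nat.card (Aut F₁) * r) := by rw [h2]; ring
  obtain ⟨P, eP, heP⟩ := exists_obj_fiber_equiv_of_finite F₁ X
  have hNpos : 0 < Nat.card N := Nat.card_pos
  have h2r : 0 < 2 * r - 1 := by omega
  refine ⟨P, by rw [Nat.card_congr eP, hcardX], ⟨eP.symm (Sum.inl ⟨⟨0, hNpos⟩, QuotientGroup.mk 1⟩),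
    fun n hn => ?_, fun n hn n' hn' heq => ?_⟩, fun b h F _ => ?_⟩
  · -- `N` fixes the base point of a `Π_v/N`-copy
    apply eP.injective
    rw [heP, Equiv.apply_symm_apply, Sum.smul_inl, Sigma.smul_mk, MulAction.Quotient.smul_mk,
      smul_eq_mul, mul_one]
    congr 2
    exact QuotientGroup.eq.mpr (by simpa using N.inv_mem hn)
  · -- distinct elements of `N` act differently on a regular copy
    have h1 := congrArg eP (heq (eP.symm (Sum.inr ⟨⟨0, h2r⟩, 1⟩)))
    rw [heP, heP, Equiv.apply_symm_apply, Sum.smul_inr, Sum.smul_inr, Sigma.smul_mk, Sigma.smul_mk,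
      smul_eq_mul, smul_eq_mul, mul_one, mul_one] at h1
    exact eq_of_heq (Sigma.mk.inj_iff.mp (Sum.inr_injective h1)).2
  · -- freeness of the pulled-back fibre over a branch at `v`
    haveI : FiberFunctor ((𝒢.pull b v h).pullback ⋙ F) :=
      fiberFunctor_comp_of_exact (𝒢.pull b v h).pullback F
    obtain ⟨α⟩ := nonempty_iso_of_fiberFunctor ((𝒢.pull b v h).pullback ⋙ F) F₁
    have hfree : ∀ (σ : Aut F) (t : F.obj ((𝒢.pull b v h).pullback.obj P)), σ • t = t → σ = 1 := by
      intro σ t ht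
      -- the image `u` of `σ` in `Π_v = Aut F₁` lies in the branch group `Π_b^α` and fixes a point
      let u : Aut F₁ := α.conjAut (pi1Map (𝒢.pull b v h).pullback F σ)
      have hu : u ∈ 𝒢.branchSubgroup F₁ b h F α := by
        refine ⟨σ, ?_⟩
        rw [MonoidHom.comp_apply, MulEquiv.coe_toMonoidHom, autMulEquivOfIso_apply]
      have hfix : u • (α.hom.app P t) = α.hom.app P t := by
        change (α.conjAut _) • _ = _
        rw [conjAut_smul_app]
        exact congrArg _ ht
      have hu1 : u = 1 := by
        have hX := congrArg eP hfix
        rw [heP] at hX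
        rcases hy : eP (α.hom.app P t) with ⟨i, q⟩ | ⟨i, g⟩
        · -- a `Π_v/N`-copy: the stabiliser of `gN` is `gNg⁻¹`, which meets `Π_b^α` trivially
          rw [hy, Sum.smul_inl, Sigma.smul_mk, Sum.inl.injEq] at hX
          have hq : u • q = q := (Sigma.mk.inj_iff.mp hX).2 |> eq_of_heq
          induction q using QuotientGroup.induction_on with
          | H g =>
            rw [MulAction.Quotient.smul_mk, smul_eq_mul, QuotientGroup.eq] at hq
            -- `(u g)⁻¹ g = g⁻¹ u⁻¹ g ∈ N`, i.e. `g⁻¹ u g ∈ N` after inversion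
            have hmem : g⁻¹ * u * g ∈ N := by
              have := N.inv_mem hq
              rwa [show ((u * g)⁻¹ * g)⁻¹ = g⁻¹ * u * g by group] at this
            have hconj : g⁻¹ * u * g ∈ ConjAct.toConjAct g⁻¹ • 𝒢.branchSubgroup F₁ b h F α := by
              rw [Subgroup.mem_pointwise_smul_iff_inv_smul_mem, ← map_inv, inv_inv, ConjAct.smul_def,
                ConjAct.ofConjAct_toConjAct, show g * (g⁻¹ * u * g) * g⁻¹ = u by group]
              exact hu
            have : g⁻¹ * u * g ∈ N ⊓ (ConjAct.toConjAct g⁻¹ • 𝒢.branchSubgroup F₁ b h F α) :=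
              ⟨hmem, hconj⟩
            rw [hN b h F α g⁻¹] at this
            rw [Subgroup.mem_bot] at this
            rw [show u = g * (g⁻¹ * u * g) * g⁻¹ by group, this]
            group
        · -- a regular copy
          rw [hy, Sum.smul_inr, Sigma.smul_mk, Sum.inr.injEq] at hX
          have hg : u • g = g := (Sigma.mk.inj_iff.mp hX).2 |> eq_of_heq
          rw [smul_eq_mul] at hg
          exact mul_eq_right.mp hg
      have h2 : pi1Map (𝒢.pull b v h).pullback F σ = 1 := by
        apply α.conjAut.injective
        rw [map_one]
        exact hu1
      exact hinj.isPi1Mono b v h F (h2.trans (map_one _).symm)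
    refine ⟨hfree, ?_⟩
    change Nat.card (((𝒢.pull b v h).pullback ⋙ F).obj P) = 2 * d
    rw [card_fiber_eq_of_iso_fiberFunctor α P, Nat.card_congr eP, hcardX]

/-- Edge groups at abutting branches of a semi-graph of anabelioids of bounded order are finite
(`Π_e ↪ Π_v`). [cite: MochizukiSemiAnbd2006, Def. 2.3(i) p.24] -/
theorem finite_aut_edge_of_isOfBoundedOrder (hbo : 𝒢.IsOfBoundedOrder) (b : 𝒢.graph.Branch)
    (v : 𝒢.graph.Vertex) (h : 𝒢.graph.abuts b = some v)
    (Fe : 𝒢.E (𝒢.graph.edgeOf b) ⥤ FintypeCat.{v₁}) [FiberFunctor Fe] : Finite (Aut Fe) := by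
  obtain ⟨M, -, hbd⟩ := hbo.exists_bound
  haveI : FiberFunctor ((𝒢.pull b v h).pullback ⋙ Fe) :=
    fiberFunctor_comp_of_exact (𝒢.pull b v h).pullback Fe
  haveI := (hbd v ((𝒢.pull b v h).pullback ⋙ Fe)).1
  exact Finite.of_injective _ (hbo.isOfInjectiveType.isPi1Mono b v h Fe)

end SemiGraphOfAnabelioids

end Literature.AnabelianGeometry.SemiGraphs
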